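import Summits.ABC.ABC.Theorems.IneffectiveSubspaceUniformSadicTowerFourThreeSlotShapes

/-!
# `UniformSadicTowerFour` (stmt-ABC-14937), line `flat-steep-split` (lead c3): the first open
# rung `W = 3` of BoundedOmegaABC is at least Pillai-hard (hardness certificate)

Modulo the route's crux #6 the crux `UniformSadicTowerFour` is BoundedOmegaABC: abc with a
constant `C(W, ε)` on every cell `{ω(abc) ≤ W}`.  Its first OPEN rung `W = 3` (`B₃`) is
equivalent (`boundedOmegaAt_three_iff_shapes`) to abc, with the bound `c < C(ε) · (pqr)^(1+ε)`, on
three exponential shapes with prime bases `p, q, r`, the third being shape (C):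
`p^x + q^y = r^z` with `p ≠ q`.

This file is the honesty certificate "rung `3` is at least Pillai-hard": shape (C) ALONE forces
the prime-base PILLAI EQUATION with gap `2`,

  `p^x − q^y = 2`, `p, q` prime, `x, y ≥ 2` (iconic solution `3³ − 5² = 2`),

to have BOUNDED solutions (`primePillaiTwo_bounded_of_shapeC`), hence so does `B₃`
(`primePillaiTwo_bounded_of_boundedOmegaAt_three`).  Pillai's conjecture (Pillai 1936/1945: for
each fixed gap `k ≥ 1` only finitely many pairs of perfect powers differ by `k`) is open for every
`k ≥ 2`, so a proof of `B₃` would in particular settle its prime-base case for the gap `k = 2`.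

**Proof.** Fix `ε := 1/10` and its shape-(C) constant `C`.  Let `q^y + 2 = p^x =: c` with `p, q`
prime and `x, y ≥ 2`.  (i) `q ≠ 2`: otherwise `p^x = 2^y + 2` is even, so `p = 2`, and
`2^x = 2^y + 2` with `x, y ≥ 2` is absurd modulo `4`.  So `(2, q, p, 1, y, x)` is an instance of
shape (C), `2^1 + q^y = p^x`, and `c < C · (2qp)^(1 + 1/10)`.  (ii) `x = y = 2` is impossible
(`p² − q² = 2` has no solution), so `x ≥ 3` or `y ≥ 3`, and in either case `(pq)^6 ≤ c^5`
(`p^6 ≤ p^{2x} = c^2` and `q^6 ≤ q^{3y} ≤ c^3`, resp. `p^6 ≤ p^{3x} = c^3` and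
`q^6 ≤ q^{2y} ≤ c^2`).  (iii) Hence `c^60 < C^60 · (2pq)^66 ≤ C^60 · 64^11 · c^55`, i.e.
`c ≤ c^5 < C^60 · 64^11`: every solution has `p^x ≤ N := ⌈C^60 · 64^11⌉₊`, a constant depending
only on `C = C(1/10)` (one regime, no case split on which exponent is large; the constant is
deliberately crude).

Sources: elementary [folklore]; the conjecture is S. S. Pillai, *On the inequality
`0 < a^x − b^y ≤ n`*, J. Indian Math. Soc. (1936), and *On the equation `2^x − 3^y = 2^X + 3^Y`*,
Bull. Calcutta Math. Soc. (1945).  Mathlib only (`Nat.prime_eq_prime_of_dvd_pow`,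
`Nat.pow_le_pow_left/right`, `pow_lt_pow_left₀`, `pow_le_pow_left₀`, `Real.rpow_natCast`,
`Real.rpow_mul`, `Nat.le_ceil`) and `boundedOmegaAt_three_iff_shapes`.  No new definitions.
Deliberately NOT here: Pillai's conjecture or the rung `B₃` themselves (OPEN; `B₃` appears only as
the explicit hypothesis `hB` of the corollary), and the other stubs of the line.
-/

noncomputable section

-- `Summit.<Summit>.<Problem>` is the mandated summit-side namespace (CONVENTIONS §2); for the
-- single-conjunct summit `ABC` the two coincide, so the duplicate `ABC.ABC` is deliberate.
set_option linter.dupNamespace false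

namespace Summit.ABC.ABC.Theorems.UniformSadicTowerFour.BoundedOmega

open Literature.NumberTheory.DiophantineGeometry (IsABCTriple rad)

/-! ## Elementary facts on the prime-base Pillai equation `q^y + 2 = p^x` -/

/-- In a solution of the prime-base Pillai equation `q ^ y + 2 = p ^ x` with `p` prime and
`x, y ≥ 2` (Pillai 1936; e.g. `5² + 2 = 3³`) the base `q` is not `2`: if `q = 2` then `p ^ x` is
even, so `p = 2`, and `2 ^ x = 2 ^ y + 2` with `x, y ≥ 2` is absurd modulo `4`. [folklore] -/
private theorem pillaiTwo_two_ne {p q x y : ℕ} (hp : p.Prime) (hx : 2 ≤ x) (hy : 2 ≤ y)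
    (hE : q ^ y + 2 = p ^ x) : 2 ≠ q := by
  rintro rfl
  have h2 : 2 ∣ p ^ x := by
    rw [← hE]
    exact dvd_add (dvd_pow_self 2 (by omega)) dvd_rfl
  obtain rfl : 2 = p := Nat.prime_eq_prime_of_dvd_pow Nat.prime_two hp h2
  obtain ⟨k, rfl⟩ := Nat.exists_eq_add_of_le' hx
  obtain ⟨l, rfl⟩ := Nat.exists_eq_add_of_le' hy
  rw [pow_add, pow_add] at hE
  omega

/-- Size bookkeeping for the prime-base Pillai equation (Pillai 1936; `3³ − 5² = 2`): in a solution
of `q ^ y + 2 = p ^ x` with `p, q` prime and `x, y ≥ 2` one has `x ≥ 3` or `y ≥ 3` (`p² − q² = 2`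
is insoluble), whence `(pq)^6 ≤ (p^x)^5`: if `x ≥ 3` then `p^6 ≤ p^{2x}` and
`q^6 ≤ q^{3y} ≤ p^{3x}`; if `y ≥ 3` then `p^6 ≤ p^{3x}` and `q^6 ≤ q^{2y} ≤ p^{2x}`
(e.g. `(3·5)^6 = 11390625 ≤ 14348907 = 27^5`). [folklore] -/
private theorem pillaiTwo_pow_six_le {p q x y : ℕ} (hp : p.Prime) (hq : q.Prime) (hx : 2 ≤ x)
    (hy : 2 ≤ y) (hE : q ^ y + 2 = p ^ x) : (p * q) ^ 6 ≤ (p ^ x) ^ 5 := by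
  have hqc : q ^ y ≤ p ^ x := by omega
  rcases Nat.lt_or_ge 2 x with hx3 | hx2
  · -- `x ≥ 3`
    calc (p * q) ^ 6 = p ^ 6 * q ^ 6 := mul_pow p q 6
    _ ≤ p ^ (x * 2) * q ^ (y * 3) :=
        Nat.mul_le_mul (Nat.pow_le_pow_right hp.pos (by omega))
          (Nat.pow_le_pow_right hq.pos (by omega))
    _ = (p ^ x) ^ 2 * (q ^ y) ^ 3 := by rw [pow_mul, pow_mul]
    _ ≤ (p ^ x) ^ 2 * (p ^ x) ^ 3 := Nat.mul_le_mul le_rfl (Nat.pow_le_pow_left hqc 3)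
    _ = (p ^ x) ^ 5 := by rw [← pow_add]
  rcases Nat.lt_or_ge 2 y with hy3 | hy2
  · -- `y ≥ 3`
    calc (p * q) ^ 6 = p ^ 6 * q ^ 6 := mul_pow p q 6
    _ ≤ p ^ (x * 3) * q ^ (y * 2) :=
        Nat.mul_le_mul (Nat.pow_le_pow_right hp.pos (by omega))
          (Nat.pow_le_pow_right hq.pos (by omega))
    _ = (p ^ x) ^ 3 * (q ^ y) ^ 2 := by rw [pow_mul, pow_mul]
    _ ≤ (p ^ x) ^ 3 * (p ^ x) ^ 2 := Nat.mul_le_mul le_rfl (Nat.pow_le_pow_left hqc 2)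
    _ = (p ^ x) ^ 5 := by rw [← pow_add]
  · -- `x = y = 2`: `p² = q² + 2` is impossible (`p > q` forces `p² ≥ q² + 2q + 1 ≥ q² + 5`)
    exfalso
    obtain rfl : x = 2 := le_antisymm hx2 hx
    obtain rfl : y = 2 := le_antisymm hy2 hy
    have h2q := hq.two_le
    rcases Nat.lt_or_ge q p with h | h
    · nlinarith [Nat.pow_le_pow_left h 2]
    · nlinarith [Nat.pow_le_pow_left h 2]

/-- The real-analysis bookkeeping of the certificate (Pillai 1936; `3³ − 5² = 2`): from the
shape-(C) bound `c < C · M^(1 + 1/10)` and `M^6 ≤ 64 · c^5` (here `M = 2pq`, `c = p^x`) follow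
`c^60 < C^60 · M^66 ≤ C^60 · 64^11 · c^55`, i.e. `c^5 < C^60 · 64^11`. [folklore] -/
private theorem pillaiTwo_pow_five_lt {C M c : ℝ} (hC : 0 < C) (hM : 0 ≤ M) (hc : 0 ≤ c)
    (h1 : c < C * M ^ ((1 : ℝ) + 1 / 10)) (h2 : M ^ 6 ≤ 64 * c ^ 5) :
    c ^ 5 < C ^ 60 * 64 ^ 11 := by
  have h3 : c ^ 60 < C ^ 60 * M ^ 66 := by
    calc c ^ 60 < (C * M ^ ((1 : ℝ) + 1 / 10)) ^ 60 := pow_lt_pow_left₀ h1 hc (by norm_num)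
    _ = C ^ 60 * M ^ 66 := by
        rw [mul_pow, ← Real.rpow_natCast (M ^ ((1 : ℝ) + 1 / 10)), ← Real.rpow_mul hM]
        norm_num
  have h4 : M ^ 66 ≤ 64 ^ 11 * c ^ 55 := by
    calc M ^ 66 = (M ^ 6) ^ 11 := by rw [← pow_mul]
    _ ≤ (64 * c ^ 5) ^ 11 := pow_le_pow_left₀ (by positivity) h2 11
    _ = 64 ^ 11 * c ^ 55 := by rw [mul_pow, ← pow_mul]
  have h5 : c ^ 5 * c ^ 55 < C ^ 60 * 64 ^ 11 * c ^ 55 := by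
    calc c ^ 5 * c ^ 55 = c ^ 60 := by rw [← pow_add]
    _ < C ^ 60 * M ^ 66 := h3
    _ ≤ C ^ 60 * (64 ^ 11 * c ^ 55) := mul_le_mul_of_nonneg_left h4 (by positivity)
    _ = C ^ 60 * 64 ^ 11 * c ^ 55 := by ring
  exact lt_of_mul_lt_mul_right h5 (pow_nonneg hc 55)

/-! ## The certificate: shape (C) bounds the prime-base Pillai equation with gap `2` -/

/-- **primePillaiTwo_bounded_of_shapeC (hardness certificate of the rung `W = 3`).** abc with the
bound `r^z < C(ε) · (pqr)^(1+ε)` on shape (C) `p^x + q^y = r^z` (`p, q, r` prime, `p ≠ q`) forces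
the prime-base PILLAI EQUATION with gap `2`, `p^x − q^y = 2` with `p, q` prime and `x, y ≥ 2`
(Pillai 1936; iconic solution `3³ − 5² = 2`), to have bounded solutions: `p^x ≤ N` for one `N`
depending only on the constant `C(1/10)`.  Proof: `q ≠ 2` by parity, so `2^1 + q^y = p^x` is an
instance of shape (C) and `p^x < C · (2qp)^(11/10)`; `x = y = 2` is impossible, so
`(pq)^6 ≤ (p^x)^5`; hence `(p^x)^5 < C^60 · 64^11`.  Pillai's conjecture being open for every gap
`k ≥ 2`, this certifies that the rung `W = 3` of BoundedOmegaABC is at least Pillai-hard.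
[folklore] -/
theorem primePillaiTwo_bounded_of_shapeC
    (hC : ∀ ε : ℝ, 0 < ε → ∃ C : ℝ, 0 < C ∧ ∀ p q r x y z : ℕ, p.Prime → q.Prime → r.Prime →
      p ≠ q → p ^ x + q ^ y = r ^ z → ((r ^ z : ℕ) : ℝ) < C * ((p * q * r : ℕ) : ℝ) ^ (1 + ε)) :
    ∃ N : ℕ, ∀ p q x y : ℕ, p.Prime → q.Prime → 2 ≤ x → 2 ≤ y → q ^ y + 2 = p ^ x →
      p ^ x ≤ N := by
  obtain ⟨C, hC0, H⟩ := hC (1 / 10) (by norm_num)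
  refine ⟨⌈C ^ 60 * 64 ^ 11⌉₊, fun p q x y hp hq hx hy hE => ?_⟩
  -- the shape-(C) instance `2 ^ 1 + q ^ y = p ^ x`
  have h1 := H 2 q p 1 y x Nat.prime_two hq hp (pillaiTwo_two_ne hp hx hy hE)
    (by rw [pow_one]; omega)
  have h2 : ((2 * q * p : ℕ) : ℝ) ^ 6 ≤ 64 * ((p ^ x : ℕ) : ℝ) ^ 5 := by
    have h6 : (2 * q * p) ^ 6 ≤ 64 * (p ^ x) ^ 5 :=
      calc (2 * q * p) ^ 6 = 64 * (p * q) ^ 6 := by ring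
      _ ≤ 64 * (p ^ x) ^ 5 := Nat.mul_le_mul_left 64 (pillaiTwo_pow_six_le hp hq hx hy hE)
    exact_mod_cast h6
  have h5 := pillaiTwo_pow_five_lt hC0 (Nat.cast_nonneg _) (Nat.cast_nonneg _) h1 h2
  have hle : ((p ^ x : ℕ) : ℝ) ≤ ((p ^ x : ℕ) : ℝ) ^ 5 := by
    exact_mod_cast Nat.le_self_pow (by norm_num) (p ^ x)
  have hlt : ((p ^ x : ℕ) : ℝ) < ((⌈C ^ 60 * 64 ^ 11⌉₊ : ℕ) : ℝ) :=
    (hle.trans_lt h5).trans_le (Nat.le_ceil _)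
  exact_mod_cast hlt.le

/-- **primePillaiTwo_bounded_of_boundedOmegaAt_three.** The first open rung `W = 3` of
BoundedOmegaABC — abc with `C = C(ε)` on the cell `ω(abc) ≤ 3` — bounds the solutions of the
prime-base Pillai equation with gap `2`, `p^x − q^y = 2` (`p, q` prime, `x, y ≥ 2`; Pillai 1936,
`3³ − 5² = 2`): by `boundedOmegaAt_three_iff_shapes` the rung contains shape (C), and
`primePillaiTwo_bounded_of_shapeC`. [folklore] -/
theorem primePillaiTwo_bounded_of_boundedOmegaAt_three
    (hB : ∀ ε : ℝ, 0 < ε → ∃ C : ℝ, 0 < C ∧ ∀ a b c : ℕ, IsABCTriple a b c →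
      (a * b * c).primeFactors.card ≤ 3 → (c : ℝ) < C * ((rad a b c : ℕ) : ℝ) ^ (1 + ε)) :
    ∃ N : ℕ, ∀ p q x y : ℕ, p.Prime → q.Prime → 2 ≤ x → 2 ≤ y → q ^ y + 2 = p ^ x →
      p ^ x ≤ N :=
  primePillaiTwo_bounded_of_shapeC (boundedOmegaAt_three_iff_shapes.mp hB).2.2

end Summit.ABC.ABC.Theorems.UniformSadicTowerFour.BoundedOmega

end
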